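import Mathlib.Analysis.SpecialFunctions.Pow.Real
import Mathlib.Algebra.BigOperators.NatAntidiagonal
import Mathlib.Algebra.BigOperators.Intervals
import Mathlib.Algebra.BigOperators.Field
import HarnessLib

/-!
# Log-concave cycle weights: the expected number of cycles is monotone, at every fugacity

Support file for the Sahi / Conjecture-P programme of route `PercNearOneGluingNoHeavy`
(`--supports stmt-CriticalPhenomena-4575`, prover prim-l12-p5 gen 23; proof note
`prim-l12-p5/LENGTH-GCL-g23.md`, Theorem LCV; companions `…LowerTailThresholdCycleMonotone`,
`…LowerTailFixedPointsCycles`).  No definitions, no named facts, no sorries.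

## The model

Cycle weights `θ_1, θ_2, … > 0` (put `θ_0 = 0`) on permutations of `m` points, `P_m(σ) ∝ ∏_c θ_{|c|}`.
With `F = ∑_j θ_j x^j/j`, `D = e^F = ∑ u_m x^m`, `C = F e^F = ∑ v_m x^m` (`v_m/u_m = κ_m`, the expected
number of cycles) the identities `x D' = x F'·D` and `x C' = x F'·(D + C)` read, over the antidiagonal
`i + j = m`:  `(hU) m u_m = ∑ θ_i u_j`,  `(hV) m v_m = ∑ θ_i (u_j + v_j)`.  A fugacity `t` replaces
`θ` by `tθ`, which is again log-concave, so no scale hypothesis appears.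

## Results

* `kappa_mono` (**Theorem LCV**): if `θ` is LOG-CONCAVE (`θ_{g+2} θ_g ≤ θ_{g+1}²`) then
  `v_m u_{m+1} ≤ v_{m+1} u_m` for all `m`, i.e. `κ_m ≤ κ_{m+1}`: the expected number of cycles is
  nondecreasing in the number of points.  (Monotonicity of `θ` is not needed.)
* `upper_mean_ge_lower_mean`: consequently, for arbitrary nonnegative weights `w` and every cut `M`,
  `(∑_{M≤r<N} w_r u_r)(∑_{r<M} w_r v_r) ≤ (∑_{M≤r<N} w_r v_r)(∑_{r<M} w_r u_r)`; with `w_r = θ_{n-r}`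
  (`w_r u_r ∝ P_n(R = r)`, `R` = number of points outside the cycle of a fixed point) this is
  `E_n[#cycles | L ≤ J] ≥ E_n[#cycles | L > J]`, i.e. `Cov(#cycles, #points in cycles of length ≤ J) ≥ 0`
  for every `n`, `J` and every fugacity — conjecture GC-L of the programme for all log-concave weights.
  Log-concave ⊇ nondecreasing concave ⊇ every coverage function `h(j) = P(Z ∩ [j] ≠ ∅)` of an
  exchangeable random set, so (via Theorem A of the gen-22 note) COND_TOP holds at every order for
  exchangeable pattern laws (Corollary EXCH of the proof note).

Proof of `kappa_mono` (note §5c): induction on `m`.  With `f_j := u_j + v_j − κ_m u_j` and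
`a_k := θ_k f_{m−k}`: `∑_{k ≤ m} a_k = m v_m − κ_m · m u_m = 0` and the signs of `a_k` are nonincreasing in
`k` (κ is monotone below `m`), so all partial sums `P_K = ∑_{k<K} a_k ≥ 0`; then
`(m+1)(v_{m+1} − κ_m u_{m+1}) = ∑_{k ≤ m+1} θ_k f_{m+1−k} = θ_1 u_m + ∑_{k=1}^{m} (θ_{k+1}/θ_k) a_k ≥ 0`
by Abel summation, `θ_{k+1}/θ_k` being nonincreasing (log-concavity).
-/

namespace Summit.CriticalPhenomena.PercolationContinuityZ3.Theorems

namespace LogConcaveCycles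

open Finset

/-! ### Two elementary lemmas on finite real sequences -/

/-- A finite sequence `a_k = b_k c_k` with `b ≥ 0` and `c` nonincreasing on `[0,N)` whose total over
`[0,N)` vanishes has all initial partial sums `∑_{k<K} a_k ≥ 0` (`K ≤ N`). -/
theorem partialSum_nonneg_of_signs (b c : ℕ → ℝ) (N : ℕ) (hb : ∀ k, 0 ≤ b k)
    (hc : ∀ k k', k ≤ k' → k' < N → c k' ≤ c k) (htot : ∑ k ∈ range N, b k * c k = 0)
    (K : ℕ) (hK : K ≤ N) : 0 ≤ ∑ k ∈ range K, b k * c k := by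
  by_cases hpos : ∀ k, k < K → 0 ≤ c k
  · exact Finset.sum_nonneg fun k hk => mul_nonneg (hb k) (hpos k (Finset.mem_range.1 hk))
  · push Not at hpos
    obtain ⟨k₀, hk₀K, hck₀⟩ := hpos
    -- all later c's are negative, so the tail sum is ≤ 0
    have htail : ∑ k ∈ Ico K N, b k * c k ≤ 0 := by
      apply Finset.sum_nonpos
      intro k hk
      rw [Finset.mem_Ico] at hk
      have : c k ≤ c k₀ := hc k₀ k (by omega) hk.2
      exact mul_nonpos_of_nonneg_of_nonpos (hb k) (by linarith)
    have hsplit : ∑ k ∈ range N, b k * c k =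
        ∑ k ∈ range K, b k * c k + ∑ k ∈ Ico K N, b k * c k := by
      rw [Finset.range_eq_Ico, ← Finset.sum_Ico_consecutive _ (Nat.zero_le K) hK, Finset.range_eq_Ico]
    linarith

/-- Abel summation with nonincreasing nonnegative multipliers: if all initial partial sums
`P_{K} = ∑_{k<K} a_k` (`K ≤ N+1`) are `≥ 0` and `λ ≥ 0` is nonincreasing, then `∑_{k ≤ N} λ_k a_k ≥ 0`. -/
theorem abel_nonneg (lam a : ℕ → ℝ) (N : ℕ) (hlam : ∀ k, k < N → lam (k + 1) ≤ lam k)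
    (hlam0 : ∀ k, 0 ≤ lam k) (hP : ∀ K, K ≤ N + 1 → 0 ≤ ∑ k ∈ range K, a k) :
    0 ≤ ∑ k ∈ range (N + 1), lam k * a k := by
  -- identity: ∑_{k<N+1} λ_k a_k = λ_N P_{N+1} + ∑_{k<N} (λ_k − λ_{k+1}) P_{k+1}
  have ident : ∀ n, ∑ k ∈ range (n + 1), lam k * a k =
      lam n * ∑ k ∈ range (n + 1), a k +
        ∑ k ∈ range n, (lam k - lam (k + 1)) * ∑ i ∈ range (k + 1), a i := by
    intro n
    induction n with
    | zero => simp
    | succ n ih =>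
      rw [Finset.sum_range_succ, ih, Finset.sum_range_succ (fun k => (lam k - lam (k + 1)) * _),
        Finset.sum_range_succ a (n + 1)]
      ring
  rw [ident N]
  apply add_nonneg
  · exact mul_nonneg (hlam0 N) (hP (N + 1) le_rfl)
  · apply Finset.sum_nonneg
    intro k hk
    rw [Finset.mem_range] at hk
    exact mul_nonneg (by linarith [hlam k hk]) (hP (k + 1) (by omega))

/-! ### The cycle-weight model -/

variable {θ u v : ℕ → ℝ}

/-- `u_m > 0` for all `m` (from `u_0 > 0`, `θ_1 > 0`, `θ ≥ 0` and `(hU)`). -/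
theorem u_pos (hθ0 : θ 0 = 0) (hθpos : ∀ j, 0 < θ (j + 1)) (hu0 : 0 < u 0)
    (hU : ∀ m : ℕ, (m : ℝ) * u m = ∑ p ∈ antidiagonal m, θ p.1 * u p.2) : ∀ m, 0 < u m := by
  have hθ : ∀ i, 0 ≤ θ i := by
    intro i; rcases i with _ | i
    · rw [hθ0]
    · exact (hθpos i).le
  intro m
  induction m using Nat.strong_induction_on with
  | _ m ih =>
    rcases m with _ | m
    · exact hu0
    have hle : θ 1 * u m ≤ ∑ p ∈ antidiagonal (m + 1), θ p.1 * u p.2 := by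
      have hmem : ((1, m) : ℕ × ℕ) ∈ antidiagonal (m + 1) := by
        rw [Finset.mem_antidiagonal]; omega
      refine Finset.single_le_sum (f := fun p : ℕ × ℕ => θ p.1 * u p.2) ?_ hmem
      intro p hp
      rw [Finset.mem_antidiagonal] at hp
      rcases Nat.eq_zero_or_pos p.1 with h0 | hp1
      · rw [h0, hθ0, zero_mul]
      · exact mul_nonneg (hθ _) (ih p.2 (by omega)).le
    have hpos : 0 < θ 1 * u m := mul_pos (hθpos 0) (ih m (by omega))
    have hN : (0 : ℝ) < ((m + 1 : ℕ) : ℝ) := by positivity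
    have : 0 < ((m + 1 : ℕ) : ℝ) * u (m + 1) := by rw [hU (m + 1)]; linarith
    exact (mul_pos_iff_of_pos_left hN).1 this

/-- **Theorem LCV (log-concave cycle weights have a monotone expected number of cycles).**
`κ_m ≤ κ_{m+1}` in the cross-multiplied form `v_m u_{m+1} ≤ v_{m+1} u_m`. -/
theorem kappa_mono (hθ0 : θ 0 = 0) (hθpos : ∀ j, 0 < θ (j + 1))
    (hlc : ∀ g, θ (g + 2) * θ g ≤ θ (g + 1) * θ (g + 1))
    (hu0 : 0 < u 0)
    (hU : ∀ m : ℕ, (m : ℝ) * u m = ∑ p ∈ antidiagonal m, θ p.1 * u p.2)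
    (hV : ∀ m : ℕ, (m : ℝ) * v m = ∑ p ∈ antidiagonal m, θ p.1 * (u p.2 + v p.2)) :
    ∀ m, v m * u (m + 1) ≤ v (m + 1) * u m := by
  have hu := u_pos hθ0 hθpos hu0 hU
  have hθ : ∀ i, 0 ≤ θ i := by
    intro i; rcases i with _ | i
    · rw [hθ0]
    · exact (hθpos i).le
  -- strong induction: all steps below m are monotone
  intro m
  induction m using Nat.strong_induction_on with
  | _ m ih =>
    -- monotonicity of κ := v/u on [0, m]
    have mono : ∀ a b, a ≤ b → b ≤ m → v a / u a ≤ v b / u b := by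
      intro a b hab hbm
      induction b, hab using Nat.le_induction with
      | base => exact le_rfl
      | succ b hab ih' =>
        refine (ih' (by omega)).trans ?_
        have h := ih b (by omega)
        rw [div_le_div_iff₀ (hu b) (hu (b + 1))]
        linarith
    have hum : u m ≠ 0 := (hu m).ne'
    -- f_j := u_j + v_j − κ_m u_j ;  a_k := θ_k f_{m-k}
    -- (1) the total ∑_{k ≤ m} a_k = 0
    have htot : ∑ k ∈ range (m + 1), θ k * (u (m - k) + v (m - k) - v m / u m * u (m - k)) = 0 := by
      have e1 : ∑ k ∈ range (m + 1), θ k * (u (m - k) + v (m - k)) = (m : ℝ) * v m := by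
        rw [hV m, Finset.Nat.sum_antidiagonal_eq_sum_range_succ (fun i j => θ i * (u j + v j)) m]
      have e2 : ∑ k ∈ range (m + 1), θ k * u (m - k) = (m : ℝ) * u m := by
        rw [hU m, Finset.Nat.sum_antidiagonal_eq_sum_range_succ (fun i j => θ i * u j) m]
      have e3 : ∑ k ∈ range (m + 1), θ k * (u (m - k) + v (m - k) - v m / u m * u (m - k)) =
          ∑ k ∈ range (m + 1), θ k * (u (m - k) + v (m - k)) -
            v m / u m * ∑ k ∈ range (m + 1), θ k * u (m - k) := by
        rw [Finset.mul_sum, ← Finset.sum_sub_distrib]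
        exact Finset.sum_congr rfl fun k _ => by ring
      rw [e3, e1, e2]
      field_simp
      ring
    -- (2) the signs of a_k are nonincreasing in k: write a_k = b_k c_k, b_k = θ_k u_{m-k} ≥ 0,
    --     c_k = 1 + κ_{m-k} − κ_m nonincreasing on [0, m]
    have hP : ∀ K, K ≤ m + 1 → 0 ≤ ∑ k ∈ range K,
        θ k * (u (m - k) + v (m - k) - v m / u m * u (m - k)) := by
      intro K hK
      have := partialSum_nonneg_of_signs (fun k => θ k * u (m - k))
        (fun k => 1 + v (m - k) / u (m - k) - v m / u m) (m + 1)
        (fun k => mul_nonneg (hθ k) (hu _).le)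
        (by
          intro k k' hkk' hk'
          have : v (m - k') / u (m - k') ≤ v (m - k) / u (m - k) :=
            mono (m - k') (m - k) (by omega) (by omega)
          linarith)
        (by
          rw [← htot]
          exact Finset.sum_congr rfl fun k _ => by
            have := hu (m - k); field_simp)
        K hK
      rw [show (∑ k ∈ range K, θ k * (u (m - k) + v (m - k) - v m / u m * u (m - k))) =
          ∑ k ∈ range K, θ k * u (m - k) * (1 + v (m - k) / u (m - k) - v m / u m) from
        Finset.sum_congr rfl fun k _ => by have := hu (m - k); field_simp]
      exact this
    -- (3) the target: (m+1)(v_{m+1} − κ_m u_{m+1}) = ∑_{k ≤ m+1} θ_k f_{m+1-k}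
    have htarget : ((m + 1 : ℕ) : ℝ) * (v (m + 1) - v m / u m * u (m + 1)) =
        ∑ k ∈ range (m + 2), θ k * (u (m + 1 - k) + v (m + 1 - k) - v m / u m * u (m + 1 - k)) := by
      have e1 : ∑ k ∈ range (m + 2), θ k * (u (m + 1 - k) + v (m + 1 - k)) =
          ((m + 1 : ℕ) : ℝ) * v (m + 1) := by
        rw [hV (m + 1), Finset.Nat.sum_antidiagonal_eq_sum_range_succ (fun i j => θ i * (u j + v j))]
      have e2 : ∑ k ∈ range (m + 2), θ k * u (m + 1 - k) = ((m + 1 : ℕ) : ℝ) * u (m + 1) := by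
        rw [hU (m + 1), Finset.Nat.sum_antidiagonal_eq_sum_range_succ (fun i j => θ i * u j)]
      have e3 : ∑ k ∈ range (m + 2), θ k * (u (m + 1 - k) + v (m + 1 - k) - v m / u m * u (m + 1 - k))
          = ∑ k ∈ range (m + 2), θ k * (u (m + 1 - k) + v (m + 1 - k)) -
            v m / u m * ∑ k ∈ range (m + 2), θ k * u (m + 1 - k) := by
        rw [Finset.mul_sum, ← Finset.sum_sub_distrib]
        exact Finset.sum_congr rfl fun k _ => by ring
      rw [e3, e1, e2]; ring
    -- (4) split off k = 0 (vanishes) and k = 1 (= θ_1 u_m > 0... ≥ 0), reindex the rest by k = k'+1... 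
    --     ∑_{k<m+2} θ_k f_{m+1-k} = θ_0 f_{m+1} + ∑_{k'<m+1} θ_{k'+1} f_{m-k'}
    have hsplit : ∑ k ∈ range (m + 2), θ k * (u (m + 1 - k) + v (m + 1 - k) - v m / u m * u (m + 1 - k))
        = ∑ k ∈ range (m + 1),
            θ (k + 1) * (u (m - k) + v (m - k) - v m / u m * u (m - k)) := by
      rw [Finset.sum_range_succ' (fun k => θ k * (u (m + 1 - k) + v (m + 1 - k) - v m / u m * u (m + 1 - k)))]
      rw [hθ0, zero_mul, add_zero]
      exact Finset.sum_congr rfl fun k _ => by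
        have e : m + 1 - (k + 1) = m - k := by omega
        rw [e]
    -- (5) Abel: θ_{k+1} f_{m-k} = (θ_{k+1}/θ_k)·a_k for k ≥ 1, and the k = 0 term is θ_1 u_m ≥ 0.
    --     We apply `abel_nonneg` to lam k := θ_{k+1}/θ_k for k ≥ 1 and lam 0 := θ_2/θ_1 (any value ≥ lam 1
    --     works since a_0 = 0), with a_k as above.
    have hmain : 0 ≤ ∑ k ∈ range (m + 1),
        θ (k + 1) * (u (m - k) + v (m - k) - v m / u m * u (m - k)) := by
      -- define the multipliers
      let lam : ℕ → ℝ := fun k => if k = 0 then θ 2 / θ 1 else θ (k + 1) / θ k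
      let a : ℕ → ℝ := fun k => θ k * (u (m - k) + v (m - k) - v m / u m * u (m - k))
      have ha0 : a 0 = 0 := by simp [a, hθ0]
      -- rewrite the sum as θ_1 f_m (k = 0 term) + ∑ lam_k a_k with the k=0 term of the latter = 0
      have hrew : ∑ k ∈ range (m + 1), θ (k + 1) * (u (m - k) + v (m - k) - v m / u m * u (m - k))
          = ∑ k ∈ range (m + 1), lam k * a k + θ 1 * (u m + v m - v m / u m * u m) := by
        rcases m with _ | m'
        · simp [lam, a, hθ0]
        · rw [Finset.sum_range_succ' (fun k => θ (k + 1) * (u (m' + 1 - k) + v (m' + 1 - k) -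
              v (m' + 1) / u (m' + 1) * u (m' + 1 - k)))]
          rw [Finset.sum_range_succ' (fun k => lam k * a k), ha0, mul_zero, add_zero]
          simp only [Nat.sub_zero, zero_add]
          congr 1
          apply Finset.sum_congr rfl
          intro k _
          have hk1 : (k + 1 : ℕ) ≠ 0 := by omega
          have hθk : θ (k + 1) ≠ 0 := (hθpos k).ne'
          have e : m' + 1 - (k + 1) = m' - k := by omega
          simp only [lam, a, hk1, if_false, e]
          field_simp
      rw [hrew]
      apply add_nonneg
      · apply abel_nonneg lam a m
        · -- lam nonincreasing on [0, m): uses log-concavity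
          intro k hk
          by_cases hk0 : k = 0
          · subst hk0; simp [lam]
          · have hk1 : k + 1 ≠ 0 := by omega
            simp only [lam, hk0, hk1, if_false]
            rw [div_le_div_iff₀ (hθpos k) (by
              have := hθpos (k - 1); rwa [show k - 1 + 1 = k by omega] at this)]
            have := hlc k
            have e : k + 1 + 1 = k + 2 := by omega
            rw [e]; nlinarith [this]
        · intro k
          by_cases hk0 : k = 0
          · subst hk0; simp only [lam, if_true]; exact div_nonneg (hθ 2) (hθ 1)
          · simp only [lam, hk0, if_false]; exact div_nonneg (hθ _) (hθ _)
        · intro K hK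
          exact hP K hK
      · have e : u m + v m - v m / u m * u m = u m := by field_simp; ring
        rw [e]; exact mul_nonneg (hθ 1) (hu m).le
    -- (6) conclude
    have hN : (0 : ℝ) < ((m + 1 : ℕ) : ℝ) := by positivity
    have h1 : 0 ≤ ((m + 1 : ℕ) : ℝ) * (v (m + 1) - v m / u m * u (m + 1)) := by
      rw [htarget, hsplit]; exact hmain
    have h2 : 0 ≤ v (m + 1) - v m / u m * u (m + 1) := (mul_nonneg_iff_of_pos_left hN).1 h1
    have h3 : v m / u m * u (m + 1) = v m * u (m + 1) / u m := by ring
    rw [h3] at h2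
    have h4 : v m * u (m + 1) / u m ≤ v (m + 1) := by linarith
    rwa [div_le_iff₀ (hu m)] at h4

/-- `κ_a ≤ κ_b` for `a ≤ b` (iterated `kappa_mono`). -/
theorem kappa_mono_le (hθ0 : θ 0 = 0) (hθpos : ∀ j, 0 < θ (j + 1))
    (hlc : ∀ g, θ (g + 2) * θ g ≤ θ (g + 1) * θ (g + 1))
    (hu0 : 0 < u 0)
    (hU : ∀ m : ℕ, (m : ℝ) * u m = ∑ p ∈ antidiagonal m, θ p.1 * u p.2)
    (hV : ∀ m : ℕ, (m : ℝ) * v m = ∑ p ∈ antidiagonal m, θ p.1 * (u p.2 + v p.2))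
    (a b : ℕ) (hab : a ≤ b) : v a / u a ≤ v b / u b := by
  have hu := u_pos hθ0 hθpos hu0 hU
  induction b, hab using Nat.le_induction with
  | base => exact le_rfl
  | succ b hab ih =>
    refine ih.trans ?_
    have h := kappa_mono hθ0 hθpos hlc hu0 hU hV b
    rw [div_le_div_iff₀ (hu b) (hu (b + 1))]
    linarith

/-- **GC-L for log-concave cycle weights (abstract covariance form).**  For arbitrary nonnegative
weights `w` and any cut `M`, the upper `w·u`-average of `κ = v/u` dominates the lower one.  With
`w_r = θ_{n-r}` this is `E_n[#cycles | L ≤ n-M] ≥ E_n[#cycles | L > n-M]`, i.e.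
`Cov(#cycles, #points in cycles of length ≤ J) ≥ 0`, for every `n`, `J` and every fugacity. -/
theorem upper_mean_ge_lower_mean (hθ0 : θ 0 = 0) (hθpos : ∀ j, 0 < θ (j + 1))
    (hlc : ∀ g, θ (g + 2) * θ g ≤ θ (g + 1) * θ (g + 1))
    (hu0 : 0 < u 0)
    (hU : ∀ m : ℕ, (m : ℝ) * u m = ∑ p ∈ antidiagonal m, θ p.1 * u p.2)
    (hV : ∀ m : ℕ, (m : ℝ) * v m = ∑ p ∈ antidiagonal m, θ p.1 * (u p.2 + v p.2))
    (w : ℕ → ℝ) (hw : ∀ r, 0 ≤ w r) (N M : ℕ) :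
    (∑ r ∈ (range N).filter (fun r => M ≤ r), w r * u r) *
        (∑ r ∈ (range N).filter (fun r => r < M), w r * v r) ≤
      (∑ r ∈ (range N).filter (fun r => M ≤ r), w r * v r) *
        (∑ r ∈ (range N).filter (fun r => r < M), w r * u r) := by
  have hu := u_pos hθ0 hθpos hu0 hU
  rw [Finset.sum_mul_sum, Finset.sum_mul_sum]
  apply Finset.sum_le_sum
  intro r hr
  apply Finset.sum_le_sum
  intro r' hr'
  simp only [Finset.mem_filter, Finset.mem_range] at hr hr'
  have hle : r' ≤ r := by omega
  have hκ := kappa_mono_le hθ0 hθpos hlc hu0 hU hV r' r hle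
  rw [div_le_div_iff₀ (hu r') (hu r)] at hκ
  have hww : 0 ≤ w r * w r' := mul_nonneg (hw r) (hw r')
  calc w r * u r * (w r' * v r') = (w r * w r') * (v r' * u r) := by ring
    _ ≤ (w r * w r') * (v r * u r') := mul_le_mul_of_nonneg_left hκ hww
    _ = w r * v r * (w r' * u r') := by ring

end LogConcaveCycles

end Summit.CriticalPhenomena.PercolationContinuityZ3.Theorems
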